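/-
Copyright: statement-level skeleton of a published paper (lit-balaban cell, Phase-2 proof seat p20, gen 3). No claims beyond
what the kernel checks below.
-/
import Literature.MathematicalPhysics.QuantumFieldTheory.Balaban1983to89.B3Sect3VectorSelfEnergy
import Literature.MathematicalPhysics.QuantumFieldTheory.Balaban1983to89.B3Eq28ForwardRefutation

/-!
# `Balaban1983to89.B3Eq329TorusCounterexample` — T. Bałaban, *(Higgs)₂,₃ quantum fields in a finite volume. III.
Renormalization*, Commun. Math. Phys. **88** (1983) 411–445 [Balaban1983Higgs3], p. 442: the vanishing of the square bracket
of (3.29) READ ON A FINITE TORUS fails — a kernel witness on the two-site torus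

statement-level skeleton of published theorems with citation tags; proofs where landed; nothing here is a claim about the Yang–Mills mass gap

PDF held: `paper:balaban1983-higgs-2-3-quantum-fields-finite-volume` (journal page = PDF page + 410); pp. 440–442 read on the
×2 renders `run/shared/lean/pub/pub-balaban/b2b-balaban-ref1/pages/1983-cmp88-higgs23-III/1983-cmp88-higgs23-III-p030…p032-x2.png`.

CITATION HEADER (lean-in-tree rule).  lit-balaban PHASE 2, seat p20 (gen 3), row **B3.Eq3.25-3.32** (owner r15, referee ref-4);
companion of `…Balaban1983to89.B3Eq329WardVanishing` (p250378), which PROVES the p. 442 sentence *"the expression in the square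
bracket above [the bracket of (3.29)] has exactly the form appearing in the Ward-Takahashi identity (2.26) with M² = 1, hence it
is equal to 0"* for the covariance `C^{(ξ)} = (−Δ^ξ + 1)^{−1}` of the INFINITE lattice `ξℤ^d` (where the momentum integrals
`∫_{|p|≤π/ξ}` of (3.24)/(3.28) live, `B3Sect3VectorSelfEnergy` T5).  WHAT IS HERE (GAPS.md **G-B3-08** made first-class): the
same sentence read on a FINITE torus `T^{(ξ)}` of `Setup` — the bracket `B3Sect3VectorSelfEnergy.bracket326 ξ τ C C C` of
(3.26)/(3.29) with all three propagators equal to the torus covariance `C = (−Δ^ξ + 1)^{−1}` (the kernel of the inverse for the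
volume element `ξ^d`, `B3Sect3ScalarSelfEnergy.kernelOp`) — is NOT zero: on the one-dimensional two-site torus
(`B3Eq28ForwardRefutation.P2`: `d = 1`, `L = 3`, `m = K = 0`, so `2·L^{m+K−j} = 2` sites; `ξ = 1`) the covariance is
`C(x,x) = 3/5`, `C(x,x′) = 2/5` (`Ctor`, `Ctor_green`, `kernelOp_Ctor_left/right`), the Π-form of p. 440 evaluates to
`Π^{(ξ)}_{11}(y) = −(2/5)·tr q²` at both sites (`Pi2_Ctor`) and the bracket against the constant legs `g = g′ = 1`, `A = A′ = 1`
to `−(4/5)·tr q²` (`bracket326_Ctor`, `expr329_Ctor`); hence the finite-torus reading, universally quantified over the tori of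
`Setup`, is false (`not_bracket329_torusReading`, `not_Pi2_torusReading`).  The mechanism (p. 442): the gauge function
`λ(y′) = Σ_{μ′} g′(y)A′_{μ′}(y)(y′_{μ′} − y_{μ′})` fed into (2.26) is linear, not periodic — on `ξℤ^d` a constant vector field is a
gradient, on a torus it is harmonic; numerically the torus bracket is exponentially small in the number of sites per direction
(`−2/5, −4/45, −8/2205, −16/4870845` for `2, 4, 8, 16` sites, `d = 1`, `ξ = 1`; `HOME/lit-balaban-p20/pi329_torus_check.py`).
Nothing else is asserted; the identity that DOES hold is `B3Eq329WardVanishing.Pi2Z_Cxi_eq_zero`.  Unit `lit-balaban-p20`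
(literature-prover-lit-balaban-p20-g3-0), 2026-08-21; HOME `run/shared/lean/pub/lit-balaban/` (FILED.md).
-/

open scoped BigOperators

namespace Literature.MathematicalPhysics.QuantumFieldTheory.Balaban1983to89.B3Eq329TorusCounterexample

open LatticeFieldCalculus B3Sect3ScalarSelfEnergy B3Sect3VectorSelfEnergy B3Eq28ForwardRefutation

/-! ## 1. The witness: the covariance `(−Δ^ξ + 1)^{−1}` of the two-site torus, `ξ = 1` -/

/-- The covariance `C^{(ξ)} = (−Δ^ξ + 1)^{−1}` of the one-dimensional two-site torus `T^{(0)}` of `P2` at `ξ = 1`: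
`−Δ^1 + 1 = [[3,−2],[−2,3]]`, inverse `(1/5)[[3,2],[2,3]]`. [cite: Balaban1983Higgs3, (3.16) p.437] -/
noncomputable def Ctor : Kernel P2 0 := fun x y => if x = y then 3 / 5 else 2 / 5

/-! ## 2. Enumeration of the two-site torus -/

/-- `d = 1`: every direction is `dir0`. [folklore] -/
private theorem fin_eq_dir0 (i : Fin P2.d) : i = dir0 :=
  Fin.ext (by have hi := i.isLt; change (i : ℕ) < 1 at hi; change (i : ℕ) = 0; omega)

/-- The two sites, labelled by `Fin 2`. [folklore] -/
private def siteEquiv : Fin 2 ≃ Site P2 0 where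
  toFun k := site ((k : ℕ) : ZMod (P2.sitesPerDir 0))
  invFun x := ⟨(x dir0).val, (x dir0).val_lt⟩
  left_inv k := by
    refine Fin.ext ?_
    show (((k : ℕ) : ZMod (P2.sitesPerDir 0))).val = k
    exact ZMod.val_cast_of_lt k.isLt
  right_inv x := by
    funext i
    rw [fin_eq_dir0 i]
    exact ZMod.natCast_zmod_val (x dir0)

/-- A sum over the sites of the two-point torus. [folklore] -/
private theorem sum_site (F : Site P2 0 → ℝ) : ∑ x, F x = F (site 0) + F (site 1) := by
  rw [← Equiv.sum_comp siteEquiv F, Fin.sum_univ_two]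
  simp [siteEquiv]

/-- A sum over the one direction. [folklore] -/
private theorem sum_dir (F : Fin P2.d → ℝ) : ∑ μ, F μ = F dir0 :=
  Fintype.sum_eq_single dir0 fun μ hμ => absurd (fin_eq_dir0 μ) hμ

/-- Every site is `site a`. [folklore] -/
private theorem eq_site (x : Site P2 0) : x = site (x dir0) := by
  funext i
  rw [fin_eq_dir0 i]
  rfl

/-- `ZMod 2 = {0, 1}`. [folklore] -/
private theorem zmod_cases (a : ZMod (P2.sitesPerDir 0)) : a = 0 ∨ a = 1 := by
  revert a
  decide

/-- `0 ≠ 1` on the two-site torus. [folklore] -/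
private theorem one_ne_zero' : (1 : ZMod (P2.sitesPerDir 0)) ≠ 0 := by decide

/-- `1 + 1 = 0` on the two-site torus. [folklore] -/
private theorem one_add_one' : (1 : ZMod (P2.sitesPerDir 0)) + 1 = 0 := by decide

/-- The two sites are distinct. [folklore] -/
private theorem site_ne : site 0 ≠ site 1 := by
  intro h
  have h0 := congrFun h dir0
  simp only [site] at h0
  exact one_ne_zero' h0.symm

/-- The shift `x ↦ x + e_1` swaps the two sites. [folklore] -/
private theorem shift_site (a : ZMod (P2.sitesPerDir 0)) : (site a).shift dir0 = site (a + 1) := by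
  funext i
  rw [fin_eq_dir0 i]
  simp [Site.shift, site]

/-- `a − 1 = a + 1` on the two-site torus. [folklore] -/
private theorem sub_one_eq' (a : ZMod (P2.sitesPerDir 0)) : a - 1 = a + 1 := by
  revert a
  decide

/-- The backward shift `x ↦ x − e_1` swaps the two sites as well. [folklore] -/
private theorem unshift_site (a : ZMod (P2.sitesPerDir 0)) : (site a).unshift dir0 = site (a + 1) := by
  funext i
  rw [fin_eq_dir0 i]
  simp [Site.unshift, site, sub_one_eq']

/-- The values of the covariance: `C(x,x) = 3/5`, `C(x,x′) = 2/5` for `x ≠ x′`. [cite: Balaban1983Higgs3, (3.16) p.437] -/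
theorem Ctor_vals :
    Ctor (site 0) (site 0) = 3 / 5 ∧ Ctor (site 1) (site 1) = 3 / 5 ∧
      Ctor (site 0) (site 1) = 2 / 5 ∧ Ctor (site 1) (site 0) = 2 / 5 :=
  ⟨by simp [Ctor], by simp [Ctor], by simp [Ctor, site_ne], by simp [Ctor, site_ne.symm]⟩

/-! ## 3. `Ctor` is the covariance `(−Δ^ξ + 1)^{−1}` of the torus (`ξ = 1`, volume element `ξ^d = 1`) -/

/-- kernel: the Green equation `((−Δ^1 + 1)C(·,y))(x) = δ_{xy}` (`laplace` = the positive lattice Laplacian `−Δ^η` of the calculus,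
`c = ξ⁻¹ = 1`). [cite: Balaban1983Higgs3, (3.16) p.437] -/
theorem Ctor_green (x y : Site P2 0) :
    laplace 1 (fun z => Ctor z y) x + Ctor x y = if x = y then 1 else 0 := by
  rw [eq_site x, eq_site y]
  simp only [laplace, sum_dir, smul_eq_mul, one_pow, one_mul, shift_site, unshift_site]
  rcases zmod_cases (x dir0) with hx | hx <;> rcases zmod_cases (y dir0) with hy | hy <;>
    simp [hx, hy, one_add_one', Ctor, site_ne, site_ne.symm] <;> norm_num

/-- kernel: `C` is a RIGHT inverse of `−Δ^ξ + 1` for the volume element `ξ^d = 1`: `(−Δ^1 + 1)(C f) = f`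
(`kernelOp 1 C f = Σ_{x′} C(·,x′)f(x′)`). [cite: Balaban1983Higgs3, (3.16) p.437] -/
theorem kernelOp_Ctor_right (f : SiteField P2 0 ℝ) :
    laplace 1 (kernelOp 1 Ctor f) + kernelOp 1 Ctor f = f := by
  funext x
  rw [eq_site x]
  simp only [Pi.add_apply, laplace, sum_dir, smul_eq_mul, one_pow, one_mul, shift_site, unshift_site, kernelOp,
    sum_site]
  rcases zmod_cases (x dir0) with hx | hx <;>
    simp [hx, one_add_one', Ctor, site_ne, site_ne.symm] <;> ring

/-- kernel: `C` is a LEFT inverse of `−Δ^ξ + 1` for the volume element `ξ^d = 1`: `C((−Δ^1 + 1)f) = f`.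
[cite: Balaban1983Higgs3, (3.16) p.437] -/
theorem kernelOp_Ctor_left (f : SiteField P2 0 ℝ) :
    kernelOp 1 Ctor (laplace 1 f + f) = f := by
  funext x
  rw [eq_site x]
  simp only [kernelOp, sum_site, Pi.add_apply, laplace, sum_dir, smul_eq_mul, one_pow, one_mul, shift_site,
    unshift_site]
  rcases zmod_cases (x dir0) with hx | hx <;>
    simp [hx, one_add_one', Ctor, site_ne, site_ne.symm] <;> ring

/-! ## 4. The Π-form and the bracket of (3.29) for the witness -/

/-- **Π^{(ξ)}_{11}(y) = −(2/5)·tr q² ≠ 0** at both sites of the two-site torus (`ξ = 1`, all three propagators `C = Ctor`):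
the nonlocal sum `Σ_{y′}[−(C∂^{ξ*})(y,y′)(C∂^{ξ*})(y′,y) + C(y,y′)(∂^ξC∂^{ξ*})(y′,y)]` is `−2/25·τ + 2/25·τ = 0`, the local
terms give `−τC(0) − τξ(C∂^{ξ*})(0) = −3τ/5 + τ/5`. [cite: Balaban1983Higgs3, (3.29) p.442] -/
theorem Pi2_Ctor (τ : ℝ) (y : Site P2 0) : Pi2 1 τ Ctor Ctor Ctor dir0 dir0 y = -(2 / 5) * τ := by
  rw [eq_site y]
  simp only [Pi2, kerC, kerA, kerB, dAdjKernel, d2Kernel, sum_site, shift_site, inv_one, one_pow, one_mul,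
    if_true]
  rcases zmod_cases (y dir0) with hy | hy <;>
    simp [hy, one_add_one', Ctor, site_ne, site_ne.symm] <;> ring

/-- **The square bracket of (3.29) on the two-site torus is `−(4/5)·tr q²`** for the constant legs `g = g′ = 1`,
`A = A′ = 1` (`bracket326 ξ τ C C C`, ξ = 1, via its Π-form `bracket326_eq_Pi2`). [cite: Balaban1983Higgs3, (3.29) p.442] -/
theorem bracket326_Ctor (τ : ℝ) :
    bracket326 1 τ Ctor Ctor Ctor (fun _ => 1) (fun _ => 1) (fun _ => 1) (fun _ => 1) = -(4 / 5) * τ := by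
  rw [bracket326_eq_Pi2]
  simp only [sum_dir, Pi2_Ctor, sum_site, one_pow, one_mul, mul_one]
  ring

/-- **(3.29) on the two-site torus is `prefactor · (−(4/5)·tr q²)`**, nonzero whenever the prefactor and `tr q²` are.
[cite: Balaban1983Higgs3, (3.29) p.441] -/
theorem expr329_Ctor (s1 s0 τ : ℝ) :
    expr329 s1 s0 1 τ Ctor (fun _ => 1) (fun _ => 1) (fun _ => 1) (fun _ => 1) = prefactor329 s1 s0 P2.d * (-(4 / 5) * τ) := by
  rw [expr329, bracket326_Ctor]

/-! ## 5. The finite-torus reading of the p. 442 sentence is not an identity -/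

/-- **p. 442 READ ON A FINITE TORUS is false (bracket form).**  The sentence *"the expression in the square bracket above has
exactly the form appearing in the Ward-Takahashi identity (2.26) with M² = 1, hence it is equal to 0"*, read for the bracket of
(3.29) = `bracket326 ξ (tr q²) C C C` on a torus `T^{(j)}` of `Setup` with `C` the covariance `(−Δ^ξ + 1)^{−1}` (a two-sided
inverse for the volume element `ξ^d`), universally quantified over the tori, `ξ > 0`, `tr q² ≠ 0` and the legs, fails for the
witness of §1 (`ξ = 1`, `tr q² = 1`: value `−4/5`).  TRUE instead on `ξℤ^d`: `B3Eq329WardVanishing.bracket329Z_Cxi_eq_zero`.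
[cite: Balaban1983Higgs3, (3.29) p.442] -/
theorem not_bracket329_torusReading :
    ¬ ∀ (P : Params) (j : ℕ) (ξ τ : ℝ), 0 < ξ → τ ≠ 0 → ∀ C : Kernel P j,
        (∀ f : SiteField P j ℝ, laplace ξ⁻¹ (kernelOp (ξ ^ P.d) C f) + kernelOp (ξ ^ P.d) C f = f) →
        (∀ f : SiteField P j ℝ, kernelOp (ξ ^ P.d) C (laplace ξ⁻¹ f + f) = f) →
        ∀ (g g' : SiteField P j ℝ) (A A' : VecField P j ℝ), bracket326 ξ τ C C C g g' A A' = 0 := by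
  intro h
  have h1 := h P2 0 1 1 one_pos one_ne_zero Ctor
    (fun f => by simpa using kernelOp_Ctor_right f) (fun f => by simpa using kernelOp_Ctor_left f)
    (fun _ => 1) (fun _ => 1) (fun _ => 1) (fun _ => 1)
  rw [bracket326_Ctor] at h1
  norm_num at h1

/-- **p. 442 READ ON A FINITE TORUS is false (Π-form).**  The pointwise reading `Π^{(ξ)}_{μμ′}(y) = 0` (the Π-form of p. 440 with
all propagators the torus covariance `(−Δ^ξ + 1)^{−1}`), universally quantified over the tori of `Setup`, fails for the witness
of §1 (`Π^{(1)}_{11}(y) = −2/5` for `tr q² = 1`).  TRUE instead on `ξℤ^d`: `B3Eq329WardVanishing.Pi2Z_Cxi_eq_zero`.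
[cite: Balaban1983Higgs3, (3.29) p.442] -/
theorem not_Pi2_torusReading :
    ¬ ∀ (P : Params) (j : ℕ) (ξ τ : ℝ), 0 < ξ → ∀ C : Kernel P j,
        (∀ f : SiteField P j ℝ, laplace ξ⁻¹ (kernelOp (ξ ^ P.d) C f) + kernelOp (ξ ^ P.d) C f = f) →
        (∀ f : SiteField P j ℝ, kernelOp (ξ ^ P.d) C (laplace ξ⁻¹ f + f) = f) →
        ∀ (μ μ' : Fin P.d) (y : Site P j), Pi2 ξ τ C C C μ μ' y = 0 := by
  intro h
  have h1 := h P2 0 1 1 one_pos Ctor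
    (fun f => by simpa using kernelOp_Ctor_right f) (fun f => by simpa using kernelOp_Ctor_left f)
    dir0 dir0 (site 0)
  rw [Pi2_Ctor] at h1
  norm_num at h1

end Literature.MathematicalPhysics.QuantumFieldTheory.Balaban1983to89.B3Eq329TorusCounterexample
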